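import Literature.AnabelianGeometry.SemiGraphs.ProSigmaClosedSurfaceSlimCore
import Literature.IUT.HodgeTheaters.ProfiniteCompletionQuotients
import HarnessLib

/-!
# Models of the pro-`Σ` completion interface: the profinite completion ([SemiAnbd] Ex. 2.10)

abc-iut-L3-t1's interface `SemiGraphOfAnabelioids.IsProSigmaCompletion Sigma ι` ([SemiAnbd] Example
2.10 p. 31, "the maximal pro-`Σ` quotient of the fundamental group") is the hypothesis structure of
[SemiAnbd] Ex. 2.10 / [AbsAnab] Lemma 1.3.1 / 1.3.7 as typed in the tree (`ProSigmaSurfaceGroupSlim`,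
`ProSigmaCuspInertiaMalnormal`, `IsOfSurfaceType`, …); every landed result about it so far is
RELATIVE to a hypothesis instance.  This proof-only file gives the interface a MODEL (non-vacuity)
and bridges it to the profinite completions used by abc-iut-L5's [IUTchI] §2 chain:

* `isProSigmaCompletion_toCompletion` — for EVERY group `G`, Mathlib's profinite completion
  `η : G → Ĝ` (`Literature.IUT.HodgeTheaters.toCompletion`) is a pro-`Σ` completion for
  `Σ = {all primes}` (dense image: Mathlib `ProfiniteCompletion.denseRange`; open normal subgroups of
  the compact group `Ĝ` have finite index; a finite-index normal `N ⊴ G` is cut out by the kernel of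
  the projection `Ĝ → G/N`);
* `isSlimGroup_profiniteCompletion_of_oneRelator` — hence, by `isSlimGroup_of_oneRelator`
  (`ProSigmaClosedSurfaceSlimCore.lean`), the profinite completion of ANY one-relator group on
  `≥ 4` generators is slim; in particular (`isSlimGroup_profiniteCompletion_surfaceGroup`,
  `center_profiniteCompletion_surfaceGroup_eq_bot`) `Ŝ_{g}` (`Γ_{g,0}`, `g ≥ 2`) is slim and
  centre-free — [AbsAnab] Lemma 1.3.1 for proper curves at `Σ = {all primes}`.

Theorems only; no side is taken on [IUTchIII] Cor. 3.12.
-/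

universe u

namespace Literature.AnabelianGeometry.SemiGraphs.SemiGraphOfAnabelioids.IsProSigmaCompletion

open Literature.AnabelianGeometry.Anabelioids Literature.AlgebraicGeometry.Frobenioids
open Literature.GroupTheory.CombinatorialGroupTheory Literature.IUT.HodgeTheaters
open CategoryTheory ProfiniteGrp ProfiniteGrp.ProfiniteCompletion

/-- **The profinite completion is a pro-`Σ` completion for `Σ = {all primes}`.**  For every group `G`,
`η : G → Ĝ` (Mathlib's `ProfiniteGrp.ProfiniteCompletion`) satisfies abc-iut-L3-t1's interface
`IsProSigmaCompletion {p | p.Prime}`: dense image, open normal subgroups of finite (hence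
`Σ`-integer) index, and every finite-index normal `N ⊴ G` is `η⁻¹` of the open kernel of `Ĝ → G/N`.
A MODEL of the interface (non-vacuity of the hypothesis structures of [SemiAnbd] Ex. 2.10).
[cite: MochizukiSemiAnbd2006, Ex. 2.10 p.31] -/
theorem isProSigmaCompletion_toCompletion (G : Type u) [Group G] :
    IsProSigmaCompletion {p : ℕ | p.Prime} (toCompletion G) := by
  classical
  refine ⟨?_, ?_, ?_⟩
  · -- dense image
    exact ProfiniteGrp.ProfiniteCompletion.denseRange (GrpCat.of G)
  · -- open normal subgroups have finite, hence `Σ`-integer, index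
    intro N _ hN
    haveI : Finite (profiniteCompletion G ⧸ N) := Subgroup.quotient_finite_of_isOpen N hN
    exact ⟨Nat.pos_of_ne_zero Subgroup.index_ne_zero_of_finite, fun p hp _ => hp⟩
  · -- a finite-index normal subgroup is cut out by the kernel of `Ĝ → G ⧸ N`
    intro N hN hσ
    haveI : N.FiniteIndex := ⟨hσ.1.ne'⟩
    let N' : FiniteIndexNormalSubgroup G := FiniteIndexNormalSubgroup.ofSubgroup N
    let π : profiniteCompletion G →* (diagram (GrpCat.of G)).obj N' :=
      MonoidHom.mk' (fun x : profiniteCompletion G => x.val N') fun _ _ => rfl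
    haveI : DiscreteTopology ((diagram (GrpCat.of G)).obj N') := ⟨rfl⟩
    have hπc : Continuous π := Literature.IUT.HodgeTheaters.ProfiniteCompletion.continuous_val N'
    refine ⟨π.ker, ?_, ?_⟩
    · change IsOpen (π ⁻¹' {1})
      exact (isOpen_discrete _).preimage hπc
    · ext g
      rw [Subgroup.mem_comap, MonoidHom.mem_ker]
      change ((toCompletion G g).val N' : G ⧸ N'.toSubgroup) = 1 ↔ g ∈ N
      rw [Literature.IUT.HodgeTheaters.ProfiniteCompletion.toCompletion_val]
      exact QuotientGroup.eq_one_iff g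

/-- **Profinite completions of one-relator groups on `≥ 4` generators are slim**: for
`Γ = ⟨α ∣ r⟩`, `α` finite with `|α| ≥ 4`, the centraliser of every open subgroup of `Γ̂` is trivial
(`isSlimGroup_of_oneRelator` at the model `isProSigmaCompletion_toCompletion`).
[cite: MochizukiAbsAnab2004, Lemma 1.3.1 p.15] -/
theorem isSlimGroup_profiniteCompletion_of_oneRelator {α : Type u} [Finite α]
    (hα : 4 ≤ Nat.card α) (r : FreeGroup α) :
    IsSlimGroup (profiniteCompletion (PresentedGroup ({r} : Set (FreeGroup α)))) :=
  isSlimGroup_of_oneRelator hα r ⟨2, Nat.prime_two⟩ (fun _ hp => hp)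
    (toCompletion (PresentedGroup ({r} : Set (FreeGroup α))))
    (isProSigmaCompletion_toCompletion _)

/-- **`Ŝ_g` is slim** ([AbsAnab] Lemma 1.3.1, proper case, at `Σ = {all primes}`): the profinite
completion of the closed surface group `Γ_{g,0}` (`g ≥ 2`) is slim.
[cite: MochizukiAbsAnab2004, Lemma 1.3.1 p.15] -/
theorem isSlimGroup_profiniteCompletion_surfaceGroup (g : ℕ) (hg : 2 ≤ g) :
    IsSlimGroup (profiniteCompletion (PuncturedSurfaceGroup g 0)) :=
  isSlimGroup_closedSurfaceGroup {p : ℕ | p.Prime} ⟨2, Nat.prime_two⟩ (fun _ hp => hp) g hg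
    (profiniteCompletion (PuncturedSurfaceGroup g 0)) (toCompletion (PuncturedSurfaceGroup g 0))
    (isProSigmaCompletion_toCompletion _)

/-- **`Ŝ_g` is centre-free** (`g ≥ 2`): a slim group has trivial centre (the whole group is an open
subgroup). [cite: MochizukiAbsAnab2004, Lemma 1.3.1 p.15] -/
theorem center_profiniteCompletion_surfaceGroup_eq_bot (g : ℕ) (hg : 2 ≤ g) :
    Subgroup.center (profiniteCompletion (PuncturedSurfaceGroup g 0)) = ⊥ := by
  have h := (isSlimGroup_profiniteCompletion_surfaceGroup g hg).centralizer_eq_bot ⊤ isOpen_univ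
  rw [eq_bot_iff] at h ⊢
  intro z hz
  exact h (Subgroup.mem_centralizer_iff.mpr fun y _ => ((Subgroup.mem_center_iff.mp hz) y))

/-! ### Existence of pro-`Σ` completions for every `Σ` -/

/-- **Every group has a pro-`Σ` completion, for every set `Σ`** (non-vacuity of the interface in
general): `P = lim_{N} G/N` over the normal subgroups `N ⊴ G` of `Σ`-integer index (a closed subgroup
of the product, profinite), `ι(g) = (gN)_N`.  Dense image and the universal property are proved as for
Mathlib's profinite completion; an open normal `M ≤ P` contains the kernel of a projection `P → G/N₀`
(`N₀` a finite intersection of `Σ`-index normal subgroups, again of `Σ`-index), so `[P : M]` is a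
`Σ`-integer. [cite: MochizukiSemiAnbd2006, Ex. 2.10 p.31] -/
theorem exists_isProSigmaCompletion (G : Type u) [Group G] (Sigma : Set ℕ) :
    ∃ (P : ProfiniteGrp.{u}) (ι : G →* P), IsProSigmaCompletion Sigma ι := by
  classical
  -- the index category: normal subgroups of `Σ`-integer index
  let J : Type u := {N : FiniteIndexNormalSubgroup G // IsSigmaInteger Sigma N.toSubgroup.index}
  let incl : J ⥤ FiniteIndexNormalSubgroup G :=
    Monotone.functor (f := fun j : J => j.1) fun _ _ h => h
  let D : J ⥤ ProfiniteGrp.{u} := incl ⋙ diagram (GrpCat.of G)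
  let P : ProfiniteGrp.{u} := ProfiniteGrp.limit D
  -- the canonical map
  let ι : G →* P :=
    { toFun := fun g => ⟨fun j => (QuotientGroup.mk g : G ⧸ j.1.toSubgroup), fun _ _ _ => rfl⟩
      map_one' := rfl
      map_mul' := fun _ _ => rfl }
  have hιval : ∀ (g : G) (j : J), (ι g).val j = (QuotientGroup.mk g : G ⧸ j.1.toSubgroup) :=
    fun _ _ => rfl
  -- finite intersections of members of `J` are members of `J`
  have hInf : ∀ I : Finset J, ∃ m : J, (m.1.toSubgroup = ⨅ j : (I : Set J), (j : J).1.toSubgroup) ∧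
      ∀ a ∈ I, m ≤ a := by
    intro I
    let M : Subgroup G := ⨅ j : (I : Set J), (j : J).1.toSubgroup
    haveI hMn : M.Normal := Subgroup.normal_iInf_normal fun j => (j : J).1.isNormal'
    haveI hMf : M.FiniteIndex := Subgroup.finiteIndex_iInf fun j => (j : J).1.isFiniteIndex'
    have hMσ : IsSigmaInteger Sigma M.index :=
      isSigmaInteger_index_iInf _ (fun j => (j : J).1.isNormal') fun j => (j : J).2
    refine ⟨⟨{ toSubgroup := M }, hMσ⟩, rfl, fun a ha => ?_⟩
    exact iInf_le (fun j : (I : Set J) => (j : J).1.toSubgroup) ⟨a, ha⟩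
  -- the projections
  have hproj : ∀ {m a : J} (f : m ⟶ a) (x : P), D.map f (x.val m) = x.val a :=
    fun f x => x.property f
  refine ⟨P, ι, ?_, ?_, ?_⟩
  · -- dense image (as in Mathlib's `ProfiniteCompletion.denseRange`)
    change DenseRange ι
    apply dense_iff_inter_open.mpr
    rintro U ⟨s, hsO, hsv⟩ ⟨⟨spc, hspc⟩, uspec⟩
    rw [← hsv, Set.mem_preimage] at uspec
    rcases (isOpen_pi_iff.mp hsO) _ uspec with ⟨I, u, hI1, hI2⟩
    obtain ⟨m, hm, hma⟩ := hInf I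
    rcases QuotientGroup.mk'_surjective m.1.toSubgroup (spc m) with ⟨g, hg⟩
    refine ⟨ι g, ?_, g, rfl⟩
    rw [← hsv]
    apply hI2
    intro a ha
    have key : (ι g).val a = spc a := by
      rw [← hproj (homOfLE (hma a ha)) (ι g), ← hspc (homOfLE (hma a ha)), hιval]
      exact congr_arg _ hg
    rw [show (ι g : Π j : J, D.obj j) a = (ι g).val a from rfl, key]
    exact (hI1 a ha).2
  · -- open normal subgroups have `Σ`-integer index
    intro M _ hMo
    obtain ⟨s, hsO, hsv⟩ := hMo
    have h1 : (1 : P).val ∈ s := by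
      have : (1 : P) ∈ Subtype.val ⁻¹' s := by rw [hsv]; exact M.one_mem
      exact this
    rcases (isOpen_pi_iff.mp hsO) _ h1 with ⟨I, u, hI1, hI2⟩
    obtain ⟨n₀, hn₀, hn₀a⟩ := hInf I
    let π₀ : P →* D.obj n₀ := MonoidHom.mk' (fun x : P => x.val n₀) fun _ _ => rfl
    have hker : π₀.ker ≤ M := by
      intro x hx
      rw [MonoidHom.mem_ker] at hx
      have hxs : x ∈ Subtype.val ⁻¹' s := by
        refine hI2 fun a ha => ?_
        have : x.val a = 1 := by
          rw [← hproj (homOfLE (hn₀a a ha)) x]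
          change D.map _ (π₀ x) = 1
          rw [hx, map_one]
        rw [show (x : Π j : J, D.obj j) a = x.val a from rfl, this]
        exact (hI1 a ha).2
      rwa [hsv] at hxs
    have hdiv : M.index ∣ π₀.ker.index := Subgroup.index_dvd_of_le hker
    rw [Subgroup.index_ker] at hdiv
    have hr : Nat.card π₀.range ∣ Nat.card (D.obj n₀) := Subgroup.card_subgroup_dvd_card _
    have hc : Nat.card (D.obj n₀) = n₀.1.toSubgroup.index := by
      change Nat.card (G ⧸ n₀.1.toSubgroup) = _
      exact (Subgroup.index_eq_card _).symm
    exact n₀.2.of_dvd (hdiv.trans (hc ▸ hr))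
  · -- universality
    intro N hN hσ
    haveI : N.FiniteIndex := ⟨hσ.1.ne'⟩
    let n₀ : J := ⟨FiniteIndexNormalSubgroup.ofSubgroup N, hσ⟩
    let π₀ : P →* D.obj n₀ := MonoidHom.mk' (fun x : P => x.val n₀) fun _ _ => rfl
    haveI : DiscreteTopology (D.obj n₀) := ⟨rfl⟩
    have hπc : Continuous π₀ :=
      (continuous_apply n₀).comp continuous_subtype_val
    refine ⟨π₀.ker, ?_, ?_⟩
    · change IsOpen (π₀ ⁻¹' {1})
      exact (isOpen_discrete _).preimage hπc
    · ext g
      rw [Subgroup.mem_comap, MonoidHom.mem_ker]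
      change ((ι g).val n₀ : G ⧸ N) = 1 ↔ g ∈ N
      rw [hιval]
      exact QuotientGroup.eq_one_iff g


end Literature.AnabelianGeometry.SemiGraphs.SemiGraphOfAnabelioids.IsProSigmaCompletion
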